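/-
Copyright (c) 2026. All rights reserved.
Released under Apache 2.0 license as described in the file LICENSE.
-/
import Mathlib
import HarnessLib
import Literature.Topology.FourManifolds.LevelPassageFraming
import Literature.Topology.FourManifolds.OddSphereTransport
import Literature.Topology.FourManifolds.CobordismEndLevelHomotopy
import Literature.Topology.FourManifolds.OpenSlabHomotopyEquiv
import Literature.Topology.FourManifolds.LevelPassageUntwisted

/-!
# An h-cobordism whose interior carries a 2-sphere without stable framing starts from an odd end

Topic `Literature/Topology/FourManifolds`. Module B2 of the proof of
`Literature.Topology.FourManifolds.exists_middleLevel_isStabilization_of_isHCobordism` (Kirby 1989,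
Ch. X p. 56: *"In the case when `M₁` is odd, the bordism `W` will not be spin"*; here in the
contrapositive elementary form needed to separate Kirby's two cases: if some map `S² → W♭` into the
interior of an h-cobordism from a simply connected closed `X₁` has no framing of `TW♭ ⊕ ℝ` along
it, then some map `S² → X₁` has no framing of `TX₁ ⊕ ℝ` along it).

* §1 `hasStableTangentFramingAlong_levelI_comp` — stable framings of a regular level lift to the
  interior along the level embedding `levelI` (lift by `Dι` and add a gradient-like vector field,
  transverse to the level; `IsStableFrameFieldOn.lift`, `StableFramesAlongDiscs.lean`).
* §2 `Cobordism.IsHCobordism.exists_not_hasStableTangentFramingAlong_left` — every map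
  `T : S² → W♭` is homotopic in `W♭` to the level embedding composed with a map into `X₁`: the open
  slab of a Morse function around its critical values and the image of `T` is a deformation
  retract of `W` (`Cobordism.exists_homotopyEquiv_openSlab`, Milnor Thm. 3.4 / Cor. 3.5), `inl` is a
  homotopy equivalence, and the low level embedding is homotopic to `inl`
  (`Cobordism.IsMorseFunction.exists_pos_diffeomorph_level_homotopic`, `CobordismEndLevelHomotopy.lean`);
  framings are homotopy invariant (`HasStableTangentFramingAlong.of_homotopic`).

Everything is proved; the only definition is the level embedding into the interior `levelI`; no
named facts.

## References

* R. C. Kirby, *The topology of 4-manifolds*, LNM 1374 (1989), Ch. X, p. 56. [Kirby1989]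
* J. Milnor, *Lectures on the h-cobordism theorem* (1965), Def. 3.1, Thm. 3.4, Cor. 3.5
  (PDF pp. 12–13). [MilnorHCobordism1965]
-/

noncomputable section

open Set Function Metric Topology Bundle Module Filter
open scoped Topology Manifold ContDiff

namespace Literature.Topology.FourManifolds

/-- Local notation: `𝔼 n` is the model Euclidean space `EuclideanSpace ℝ (Fin n)`. -/
local notation "𝔼 " n:arg => EuclideanSpace ℝ (Fin n)

/-- Local notation: the unit `2`-sphere. -/
local notation "𝕊²" => (sphere (0 : EuclideanSpace ℝ (Fin (2 + 1))) 1)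

open Cobordism StableFrames

/-! ### 1. Framings of a level lift to framings of the interior along the level -/

section Level

variable {X₁ X₂ : Type} [TopologicalSpace X₁] [ChartedSpace (𝔼 4) X₁] [TopologicalSpace X₂] [ChartedSpace (𝔼 4) X₂]

variable {c : Cobordism 4 X₁ X₂} {f : c.W → ℝ} (hf : c.IsMorseFunction f) {b : ℝ} (hb : b ∈ Ioo (0 : ℝ) 1)
  (V : Type) [TopologicalSpace V] [ChartedSpace (𝔼 4) V] [IsManifold (𝓡 4) ∞ V]
  (ι : V → c.W) (hι : Manifold.IsSmoothEmbedding (𝓡 4) (𝓡∂ (4 + 1)) ∞ ι) (hιr : range ι = f ⁻¹' {b})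

include hιr in
omit [TopologicalSpace V] [ChartedSpace (𝔼 4) V] [IsManifold (𝓡 4) ∞ V] in
/-- The level is at height `b`. [folklore] -/
theorem apply_level (v : V) : f (ι v) = b := by
  have : ι v ∈ range ι := mem_range_self v
  rw [hιr] at this; exact this

/-- **The level embedding into the interior `W♭`.** [folklore] -/
def levelI (v : V) : PassageSetting.Wb c :=
  ⟨ι v, hf.isInteriorPoint_of_apply_mem_Ioo (by rw [apply_level V ι hιr v]; exact hb)⟩

omit [TopologicalSpace V] [ChartedSpace (𝔼 4) V] [IsManifold (𝓡 4) ∞ V] in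
/-- The underlying point of the level embedding. [folklore] -/
@[simp] theorem levelI_val (v : V) : (levelI hf hb V ι hιr v).val = ι v := rfl

include hι in
omit [IsManifold (𝓡 4) ∞ V] in
/-- The level embedding into the interior is smooth. [folklore] -/
theorem contMDiff_levelI : ContMDiff (𝓡 4) (𝓡 (4 + 1)) ∞ (levelI hf hb V ι hιr) :=
  InteriorManifold.contMDiff_iff_comp_val.mpr hι.contMDiff

include hι in
omit [IsManifold (𝓡 4) ∞ V] in
/-- The differential of the level embedding into the interior is that of `ι`. [folklore] -/
theorem mfderiv_levelI (v : V) :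
    mfderiv (𝓡 4) (𝓡 (4 + 1)) (levelI hf hb V ι hιr) v = mfderiv (𝓡 4) (𝓡∂ (4 + 1)) ι v := by
  have hn : (∞ : WithTop ℕ∞) ≠ 0 := by simp
  exact (InteriorManifold.mfderiv_comp_val ((contMDiff_levelI hf hb V ι hι hιr v).mdifferentiableAt hn)).symm

include hι in
omit [IsManifold (𝓡 4) ∞ V] in
/-- The level embedding into the interior has injective differential. [folklore] -/
theorem mfderiv_levelI_injective (v : V) : Injective (mfderiv (𝓡 4) (𝓡 (4 + 1)) (levelI hf hb V ι hιr) v) := by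
  rw [mfderiv_levelI hf hb V ι hι hιr]
  exact mfderiv_injective_of_isImmersion hι.isImmersion (by simp) v

include hι in
/-- **Stable framings of the level lift to stable framings of the interior along the level**
(lift the frame by `Dι` and add a gradient-like vector field, which is transverse to the level:
`X(f) > 0` at regular points while `D(f ∘ ι) = 0`). [cite: MilnorHCobordism1965, Def. 3.1 (1)] -/
theorem hasStableTangentFramingAlong_levelI_comp (hreg : ∀ z ∈ criticalSet (𝓡∂ (4 + 1)) f, f z ≠ b)
    {K : Type*} [TopologicalSpace K] {k : K → V} (h : HasStableTangentFramingAlong (𝓡 4) V k) :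
    HasStableTangentFramingAlong (𝓡 (4 + 1)) (PassageSetting.Wb c) (levelI hf hb V ι hιr ∘ k) := by
  obtain ⟨ξ, hξ⟩ := Cobordism.Milnor1965_exists_isGradientLike_holds hf
  obtain ⟨F, hF⟩ := h.exists_isStableFrameFieldOn
  have hn : (∞ : WithTop ℕ∞) ≠ 0 := by simp
  -- the field along the level, read in the interior
  set ξV : V → 𝔼 (4 + 1) := fun v => ξ (ι v) with hξV
  have hξc : Continuous fun v => (TotalSpace.mk' (𝔼 (4 + 1)) (levelI hf hb V ι hιr v) (ξV v) :
      TangentBundle (𝓡 (4 + 1)) (PassageSetting.Wb c)) := by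
    rw [← continuousOn_univ, InteriorManifold.continuousOn_totalSpaceMk_iff
      (contMDiff_levelI hf hb V ι hι hιr).continuous.continuousOn, continuousOn_univ]
    exact ξ.contMDiff.continuous.comp hι.isEmbedding.continuous
  have hξt : ∀ v, ξV v ∉ LinearMap.range (mfderiv (𝓡 4) (𝓡 (4 + 1)) (levelI hf hb V ι hιr) v).toLinearMap := by
    rintro v ⟨w, hw⟩
    have hvb := apply_level V ι hιr v
    have hnc : ¬ IsMCriticalPt (𝓡∂ (4 + 1)) f (ι v) := fun hc => hreg (ι v) (mem_criticalSet.mpr hc) hvb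
    have hpos := hξ.mlineDeriv_pos (ι v) hnc
    have hcomp : HasMFDerivAt (𝓡 4) 𝓘(ℝ, ℝ) (f ∘ ι) v
        ((mfderiv (𝓡∂ (4 + 1)) 𝓘(ℝ, ℝ) f (ι v)).comp (mfderiv (𝓡 4) (𝓡∂ (4 + 1)) ι v)) :=
      (hf.isMorse.contMDiff.mdifferentiableAt (by simp) : MDifferentiableAt (𝓡∂ (4 + 1)) 𝓘(ℝ, ℝ) f (ι v)).hasMFDerivAt.comp v
        ((hι.contMDiff v).mdifferentiableAt hn).hasMFDerivAt
    have hconst : f ∘ ι = fun _ => b := funext fun w => apply_level V ι hιr w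
    rw [hconst] at hcomp
    have hzero : HasMFDerivAt (𝓡 4) 𝓘(ℝ, ℝ) (fun _ : V => b) v (0 : TangentSpace (𝓡 4) v →L[ℝ] ℝ) :=
      hasMFDerivAt_const b v
    have heq := hcomp.mfderiv.symm.trans hzero.mfderiv
    have hw' : mfderiv (𝓡 4) (𝓡∂ (4 + 1)) ι v w = ξ (ι v) := by
      rw [← mfderiv_levelI hf hb V ι hι hιr]; exact hw
    have h0 : mfderiv (𝓡∂ (4 + 1)) 𝓘(ℝ, ℝ) f (ι v) (mfderiv (𝓡 4) (𝓡∂ (4 + 1)) ι v w) = 0 :=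
      congrArg (fun T : TangentSpace (𝓡 4) v →L[ℝ] ℝ => T w) heq
    rw [hw'] at h0
    exact hpos.ne' h0
  have hlift := hF.lift (levelI hf hb V ι hιr) ξV ((contMDiff_levelI hf hb V ι hι hιr).of_le (by simp))
    (mfderiv_levelI_injective hf hb V ι hι hιr) hξc hξt
  exact hlift.hasStableTangentFramingAlong

end Level

/-! ### 2. The bridge: an odd interior forces an odd end -/

section Bridge

variable {X₁ X₂ : Type} [TopologicalSpace X₁] [T2Space X₁] [SecondCountableTopology X₁]
  [ChartedSpace (𝔼 4) X₁] [IsManifold (𝓡 4) ∞ X₁] [CompactSpace X₁]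
  [TopologicalSpace X₂] [T2Space X₂] [SecondCountableTopology X₂]
  [ChartedSpace (𝔼 4) X₂] [IsManifold (𝓡 4) ∞ X₂] [CompactSpace X₂]

/-- **If the interior of an h-cobordism from a simply connected closed 4-manifold `X₁` carries a
map `S² → W♭` without stable tangent framing, then so does `X₁`** (Kirby 1989, Ch. X p. 56: *"In
the case when `M₁` is odd, the bordism `W` will not be spin"* — in contrapositive, elementary
form).  Every map `T : S² → W♭` is homotopic in `W♭` to a map into a low level `V ≅ X₁`: the open
slab of `f` around the critical values and the image of `T` is a deformation retract of `W`
(`Cobordism.exists_homotopyEquiv_openSlab`, Milnor Thm. 3.4 / Cor. 3.5), `inl : X₁ → W` is a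
homotopy equivalence, and the level embedding is homotopic to `inl`
(`exists_pos_diffeomorph_level_homotopic`); a stable framing of `X₁` along the resulting map
lifts to `W♭` along the level (`hasStableTangentFramingAlong_levelI_comp`) and is transported
along the homotopy (`HasStableTangentFramingAlong.of_homotopic`). [cite: Kirby1989, Ch. X p. 56] [cite: MilnorHCobordism1965, Thm. 3.4, Cor. 3.5 (PDF pp. 12–13)] -/
theorem Cobordism.IsHCobordism.exists_not_hasStableTangentFramingAlong_left [SimplyConnectedSpace X₁]
    (c : Cobordism 4 X₁ X₂) (hc : c.IsHCobordism)
    (hT : ∃ T : C(𝕊², PassageSetting.Wb c), ¬ HasStableTangentFramingAlong (𝓡 (4 + 1)) (PassageSetting.Wb c) T) :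
    ∃ h : C(𝕊², X₁), ¬ HasStableTangentFramingAlong (𝓡 4) X₁ h := by
  classical
  haveI := Fact.mk (@finrank_euclideanSpace_fin ℝ _ (2 + 1))
  by_contra hall
  push Not at hall
  obtain ⟨T, hT⟩ := hT
  apply hT
  -- a Morse function and its critical values
  obtain ⟨f, hf, -, -⟩ := exists_isMorseFunction_two_three_of_isHCobordism_holds X₁ X₂ c hc
  have hfc : Continuous f := hf.isMorse.contMDiff.continuous
  have hfin : (criticalSet (𝓡∂ (4 + 1)) f).Finite := IsMorse.finite_criticalSet_holds hf.isMorse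
  have hcritI : ∀ z ∈ criticalSet (𝓡∂ (4 + 1)) f, f z ∈ Ioo (0 : ℝ) 1 := fun z hz => by
    have hint : (𝓡∂ (4 + 1)).IsInteriorPoint z := by
      by_contra hb
      exact hf.2.2.2.1 z (((𝓡∂ (4 + 1)).isBoundaryPoint_iff_not_isInteriorPoint z).2 hb) hz
    exact hf.2.2.2.2 z hint
  -- the values of `f` on the image of `T`
  haveI : Nonempty c.W := ⟨(T (Classical.arbitrary 𝕊²)).val⟩
  set tf : 𝕊² → ℝ := fun x => f (T x).val with htf
  have htfc : Continuous tf := hfc.comp (continuous_induced_dom.comp T.continuous)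
  have htfI : ∀ x, tf x ∈ Ioo (0 : ℝ) 1 := fun x => hf.2.2.2.2 _ (T x).2
  obtain ⟨x₀, -, hx₀⟩ := isCompact_univ.exists_isMinOn univ_nonempty htfc.continuousOn
  obtain ⟨x₁, -, hx₁⟩ := isCompact_univ.exists_isMaxOn univ_nonempty htfc.continuousOn
  have hmin : ∀ x, tf x₀ ≤ tf x := fun x => hx₀ (mem_univ x)
  have hmax : ∀ x, tf x ≤ tf x₁ := fun x => hx₁ (mem_univ x)
  -- bounds `m₀ ≤` all critical values and `≤ tf`, `M₁ ≥` all critical values and `≥ tf`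
  set vals : Finset ℝ := hfin.toFinset.image f with hvals
  set m₀ : ℝ := (insert (tf x₀) vals).min' (Finset.insert_nonempty _ _) with hm₀
  set M₁ : ℝ := (insert (tf x₁) vals).max' (Finset.insert_nonempty _ _) with hM₁
  have hm₀pos : 0 < m₀ := by
    rw [hm₀, Finset.lt_min'_iff]
    intro y hy
    rcases Finset.mem_insert.mp hy with rfl | hy
    · exact (htfI x₀).1
    · obtain ⟨z, hz, rfl⟩ := Finset.mem_image.mp hy
      exact (hcritI z (hfin.mem_toFinset.mp hz)).1
  have hM₁lt : M₁ < 1 := by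
    rw [hM₁, Finset.max'_lt_iff]
    intro y hy
    rcases Finset.mem_insert.mp hy with rfl | hy
    · exact (htfI x₁).2
    · obtain ⟨z, hz, rfl⟩ := Finset.mem_image.mp hy
      exact (hcritI z (hfin.mem_toFinset.mp hz)).2
  have hm₀tf : ∀ x, m₀ ≤ tf x := fun x =>
    (Finset.min'_le _ _ (Finset.mem_insert_self _ _)).trans (hmin x)
  have hM₁tf : ∀ x, tf x ≤ M₁ := fun x =>
    (hmax x).trans (Finset.le_max' _ _ (Finset.mem_insert_self _ _))
  have hm₀crit : ∀ z ∈ criticalSet (𝓡∂ (4 + 1)) f, m₀ ≤ f z := fun z hz =>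
    Finset.min'_le _ _ (Finset.mem_insert_of_mem (Finset.mem_image_of_mem f (hfin.mem_toFinset.mpr hz)))
  have hM₁crit : ∀ z ∈ criticalSet (𝓡∂ (4 + 1)) f, f z ≤ M₁ := fun z hz =>
    Finset.le_max' _ _ (Finset.mem_insert_of_mem (Finset.mem_image_of_mem f (hfin.mem_toFinset.mpr hz)))
  have hm₀M₁ : m₀ ≤ M₁ := (hm₀tf x₀).trans (hM₁tf x₀)
  -- the low level `ε` and the slab `(ℓ₀, ℓ₁)`
  obtain ⟨ε₀, hε₀, hlev⟩ := hf.exists_pos_diffeomorph_level_homotopic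
  set ε : ℝ := min ε₀ (m₀ / 2) with hε
  have hεpos : 0 < ε := lt_min hε₀ (by linarith)
  have hεε₀ : ε ≤ ε₀ := min_le_left _ _
  have hεm₀ : ε < m₀ := (min_le_right _ _).trans_lt (by linarith)
  set ℓ₀ : ℝ := ε / 2 with hℓ₀
  set ℓ₁ : ℝ := (M₁ + 1) / 2 with hℓ₁
  have hℓ₀pos : 0 < ℓ₀ := by rw [hℓ₀]; linarith
  have hℓ₀ε : ℓ₀ < ε := by rw [hℓ₀]; linarith
  have hM₁ℓ₁ : M₁ < ℓ₁ := by rw [hℓ₁]; linarith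
  have hℓ₁1 : ℓ₁ < 1 := by rw [hℓ₁]; linarith
  have hεℓ₁ : ε < ℓ₁ := hεm₀.trans_le (hm₀M₁.trans hM₁ℓ₁.le)
  have hℓ₀₁ : ℓ₀ < ℓ₁ := hℓ₀ε.trans hεℓ₁
  have hε1 : ε < 1 := hεℓ₁.trans hℓ₁1
  have hcritU : ∀ z ∈ criticalSet (𝓡∂ (4 + 1)) f, f z ∈ Ioo ℓ₀ ℓ₁ := fun z hz =>
    ⟨hℓ₀ε.trans (hεm₀.trans_le (hm₀crit z hz)), (hM₁crit z hz).trans_lt hM₁ℓ₁⟩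
  have hreg : ∀ z ∈ criticalSet (𝓡∂ (4 + 1)) f, f z ≠ ε := fun z hz h =>
    absurd (hεm₀.trans_le (hm₀crit z hz)) (by rw [h]; exact lt_irrefl _)
  -- the slab is a deformation retract of `W`
  obtain ⟨eU, heU⟩ := Cobordism.exists_homotopyEquiv_openSlab hf hℓ₀pos hℓ₀₁ hℓ₁1 hcritU
  -- the level `ε` and its diffeomorphism with `X₁`, homotopic to `inl`
  have hlevε : IsRegularLevel (𝓡∂ (4 + 1)) f ε := hf.isRegularLevel ⟨hεpos, hε1⟩ fun z hz => hreg z hz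
  obtain ⟨φ, hφ⟩ := hlev ε hεpos hεε₀ (RegularLevel hlevε) (RegularLevel.incl hlevε) (RegularLevel.isSmoothEmbedding_incl hlevε)
    (RegularLevel.range_incl hlevε)
  set ι := RegularLevel.incl hlevε with hιdef
  have hι := RegularLevel.isSmoothEmbedding_incl hlevε
  have hιr := RegularLevel.range_incl hlevε
  have hιε : ∀ v, f (ι v) = ε := apply_level (RegularLevel hlevε) ι hιr
  -- `inl` as a homotopy equivalence
  obtain ⟨E₁, hE₁⟩ := hc.1
  -- the maps into the slab `U = f⁻¹(ℓ₀, ℓ₁)`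
  set jU : C(X₁, ↥(f ⁻¹' Ioo ℓ₀ ℓ₁)) := ⟨fun x => ⟨ι (φ x), show f (ι (φ x)) ∈ Ioo ℓ₀ ℓ₁ by rw [hιε]; exact ⟨hℓ₀ε, hεℓ₁⟩⟩,
    (hι.isEmbedding.continuous.comp φ.continuous).subtype_mk _⟩ with hjU
  have hTU : ∀ x, (T x).val ∈ f ⁻¹' Ioo ℓ₀ ℓ₁ := fun x =>
    ⟨hℓ₀ε.trans (hεm₀.trans_le (hm₀tf x)), (hM₁tf x).trans_lt hM₁ℓ₁⟩
  set TU : C(𝕊², ↥(f ⁻¹' Ioo ℓ₀ ℓ₁)) := ⟨fun x => ⟨(T x).val, hTU x⟩, (continuous_induced_dom.comp T.continuous).subtype_mk _⟩ with hTUdef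
  -- ### Claim A: `TU ≃ jU ∘ h` in the slab, `h = E₁⁻¹ ∘ val ∘ TU`
  set h : C(𝕊², X₁) := E₁.invFun.comp (eU.toFun.comp TU) with hh
  have hval_jU' : eU.toFun.comp jU = (⟨ι ∘ φ, hι.isEmbedding.continuous.comp φ.continuous⟩ : C(X₁, c.W)) := by
    ext x; exact heU _
  have hinl_eq : E₁.toFun = (⟨c.inl, c.isSmoothEmbedding_inl.isEmbedding.continuous⟩ : C(X₁, c.W)) := by
    ext x; exact congrFun hE₁ x
  -- (d) `eU⁻¹ ∘ inl ≃ jU`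
  have hd : (eU.invFun.comp E₁.toFun).Homotopic jU := by
    have h1 : (eU.invFun.comp E₁.toFun).Homotopic (eU.invFun.comp (eU.toFun.comp jU)) := by
      rw [hinl_eq, hval_jU']
      exact ContinuousMap.Homotopic.comp (ContinuousMap.Homotopic.refl _) hφ
    have h2 : (eU.invFun.comp (eU.toFun.comp jU)).Homotopic ((ContinuousMap.id _).comp jU) := by
      rw [← ContinuousMap.comp_assoc]
      exact ContinuousMap.Homotopic.comp eU.left_inv (ContinuousMap.Homotopic.refl jU)
    rw [ContinuousMap.id_comp] at h2
    exact ContinuousMap.Homotopic.trans h1 h2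
  -- (a)–(c) `TU ≃ (eU⁻¹ ∘ inl) ∘ h`
  have hac : TU.Homotopic ((eU.invFun.comp E₁.toFun).comp h) := by
    have h1 : TU.Homotopic (eU.invFun.comp (eU.toFun.comp TU)) := by
      have := ContinuousMap.Homotopic.comp (ContinuousMap.Homotopic.symm eU.left_inv) (ContinuousMap.Homotopic.refl TU)
      rw [ContinuousMap.id_comp, ContinuousMap.comp_assoc] at this
      exact this
    have h2 : (eU.toFun.comp TU).Homotopic ((E₁.toFun.comp E₁.invFun).comp (eU.toFun.comp TU)) := by
      have := ContinuousMap.Homotopic.comp (ContinuousMap.Homotopic.symm E₁.right_inv) (ContinuousMap.Homotopic.refl (eU.toFun.comp TU))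
      rw [ContinuousMap.id_comp] at this
      exact this
    have h3 := ContinuousMap.Homotopic.comp (ContinuousMap.Homotopic.refl eU.invFun) h2
    refine ContinuousMap.Homotopic.trans h1 ?_
    have heq : (eU.invFun.comp ((E₁.toFun.comp E₁.invFun).comp (eU.toFun.comp TU))) = (eU.invFun.comp E₁.toFun).comp h := by
      rw [hh]; ext x; rfl
    rw [← heq]
    exact h3
  have hA : TU.Homotopic (jU.comp h) :=
    ContinuousMap.Homotopic.trans hac (ContinuousMap.Homotopic.comp hd (ContinuousMap.Homotopic.refl h))
  -- ### push into the interior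
  have hUint : ∀ u : ↥(f ⁻¹' Ioo ℓ₀ ℓ₁), (𝓡∂ (4 + 1)).IsInteriorPoint u.val := fun u =>
    hf.isInteriorPoint_of_apply_mem_Ioo ⟨hℓ₀pos.trans u.2.1, u.2.2.trans hℓ₁1⟩
  set inclI : C(↥(f ⁻¹' Ioo ℓ₀ ℓ₁), PassageSetting.Wb c) := ⟨fun u => ⟨u.val, hUint u⟩,
    continuous_induced_rng.mpr continuous_subtype_val⟩ with hinclI
  have hTeq : inclI.comp TU = T := by
    ext x : 1; rfl
  set Lφ : C(X₁, PassageSetting.Wb c) := ⟨levelI hf ⟨hεpos, hε1⟩ (RegularLevel hlevε) ι hιr ∘ φ,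
    (contMDiff_levelI hf ⟨hεpos, hε1⟩ (RegularLevel hlevε) ι hι hιr).continuous.comp φ.continuous⟩ with hLφ
  have hjeq : inclI.comp jU = Lφ := by
    ext x : 1; rfl
  have hTh : T.Homotopic (Lφ.comp h) := by
    rw [← hTeq, ← hjeq, ContinuousMap.comp_assoc]
    exact ContinuousMap.Homotopic.comp (ContinuousMap.Homotopic.refl inclI) hA
  -- ### framings
  have hX : HasStableTangentFramingAlong (𝓡 4) X₁ h := hall h
  have hV : HasStableTangentFramingAlong (𝓡 4) (RegularLevel hlevε) (φ ∘ h) := hX.diffeomorph_comp φ (by simp)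
  have hW := hasStableTangentFramingAlong_levelI_comp hf ⟨hεpos, hε1⟩ (RegularLevel hlevε) ι hι hιr hreg hV
  exact HasStableTangentFramingAlong.of_homotopic (ContinuousMap.Homotopic.symm hTh) hW

end Bridge

end Literature.Topology.FourManifolds
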